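import Summits.ResolutionOfSingularities.ResolutionOfSingularities.Theorems.WeightedInvariantIota3TwoFlagExtended
import HarnessLib

/-!
# TRACE DESCENT of stable ideals, and the σ-maximiser descent it yields («(G2)+(G4)» of the Galois route; door
# `HypersurfaceCentreConstruction`, stmt-ResolutionOfSingularities-19897; P3 rung (c11σ)/(o53-desc′); hand res-L1-w43-stub-3)

Topic: `Summits/ResolutionOfSingularities/ResolutionOfSingularities/Theorems`. Helper for the door item
`HypersurfaceCentreConstruction` (stmt-ResolutionOfSingularities-19897, route `WeightedInvariant`), line `local-engine` (L W4.3),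
def-free.

**§1 Trace descent (abstract Speiser argument).**  `A → B` commutative, `Γ` a finite family of `A`-algebra endomorphisms of `B`,
`t : B → A` an `A`-valued «trace» with `φ(t y) = Σ_{γ∈Γ} γ y`, and a «trace-dual pair» `b, c : ι → B` with the reproducing identity
`x = Σᵢ φ(t(x·bᵢ))·cᵢ` for all `x`.  Then every ideal `J ⊆ B` stable under `Γ` is EXTENDED: `J = (J ∩ A)·B`
(`Ideal.eq_map_comap_of_stable`).  (Instances: `B = A ⊗_k L`, `L/k` finite Galois, `Γ = id ⊗ Gal`, `t = id ⊗ tr_{L/k}`, `(bᵢ), (cᵢ)`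
a trace-dual pair of bases of `L/k` — in particular `A ⊗_{𝔽_q} 𝔽_{q^n}` with `Γ = ⟨id ⊗ Frob⟩`; typed separately.)

**§2 Consequence for two-flags (with «LEMMA R», p567714).**  Along a flat local `φ : S → S'` with `𝔪S' = 𝔪'` carrying such a
descent datum, a two-flag `(g₁', g₂')` of `S'` whose levels `F'(r₁)`, `F'(r₂)` are `Γ`-STABLE is, filtration-wise, the image of a
two-flag of `S` (`exists_isTwoFlag_eq_of_stable`), and every reach through it descends (`flagReaches_of_stable`).  With (J-can)
((o70-b), res-D-brk-1) the filtration of a σ-maximiser is stable under every `S`-automorphism of `S'` fixing nothing but `S` — this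
is how σ-maximisers (hence the level letter σ₂) descend along Galois-type residue extensions; two-flag reach in general does NOT
descend (memo O53-DESC-CEX).

[OURS · L1 W4.3 · (o53-desc′) (G2)/(G4)]  Replaces the role of NO printed item; NOT a statement of the manuscript
[claim: Hironaka2017, status: under-review]. AI work, weaker than expert review.  No named facts.

## References

* A. Speiser, *Zahlentheoretische Sätze aus der Gruppentheorie*, Math. Z. 5 (1919) (Galois descent). [folklore]
* A. Grothendieck, *EGA IV*, Publ. Math. IHÉS 20 (1964), 0_IV (19.7.1). [EGA0IV]
* H. Hironaka, *Characteristic polyhedra of singularities*, J. Math. Kyoto Univ. 7 (1967), §3. [Hironaka1967]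
-/

noncomputable section

open IsLocalRing Literature.AlgebraicGeometry.Resolution
open Summit.ResolutionOfSingularities.ResolutionOfSingularities.Cruxes.HypersurfaceCentreConstruction.LocalEngine
open Summit.ResolutionOfSingularities.ResolutionOfSingularities.Cruxes.HypersurfaceCentreConstruction.LocalEngine.Iota3

set_option linter.dupNamespace false -- mandated namespace of this single-conjunct summit

namespace Summit.ResolutionOfSingularities.ResolutionOfSingularities.Theorems

namespace TraceDescent

/-! ## §1 Trace descent of stable ideals -/

section Abstract

variable {A B : Type*} [CommRing A] [CommRing B] [Algebra A B]

/-- **TRACE DESCENT (Speiser)**: with an `A`-valued trace `t` (`φ ∘ t = Σ_{γ∈Γ} γ`) and a reproducing pair `x = Σᵢ φ(t(x bᵢ)) cᵢ`, every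
ideal of `B` stable under the finite family `Γ` of `A`-algebra endomorphisms is extended from `A`: `J = (J.comap φ).map φ`. [folklore] -/
theorem Ideal.eq_map_comap_of_stable {κ ι : Type*} [Fintype κ] [Fintype ι] (Γ : κ → (B →ₐ[A] B)) (t : B → A)
    (ht : ∀ y, algebraMap A B (t y) = ∑ k, Γ k y) (b c : ι → B)
    (hdual : ∀ x, x = ∑ i, algebraMap A B (t (x * b i)) * c i) (J : Ideal B) (hJ : ∀ k, ∀ x ∈ J, Γ k x ∈ J) :
    J = (J.comap (algebraMap A B)).map (algebraMap A B) := by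
  refine le_antisymm (fun x hx => ?_) Ideal.map_comap_le
  rw [hdual x]
  refine Ideal.sum_mem _ fun i _ => Ideal.mul_mem_right _ _ (Ideal.mem_map_of_mem _ ?_)
  rw [Ideal.mem_comap, ht]
  exact Ideal.sum_mem _ fun k _ => hJ k _ (Ideal.mul_mem_right _ _ hx)

/-- The comap form: a stable ideal is the extension of SOME ideal of `A`. [folklore] -/
theorem exists_map_eq_of_stable {κ ι : Type*} [Fintype κ] [Fintype ι] (Γ : κ → (B →ₐ[A] B)) (t : B → A)
    (ht : ∀ y, algebraMap A B (t y) = ∑ k, Γ k y) (b c : ι → B)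
    (hdual : ∀ x, x = ∑ i, algebraMap A B (t (x * b i)) * c i) (J : Ideal B) (hJ : ∀ k, ∀ x ∈ J, Γ k x ∈ J) :
    ∃ I : Ideal A, I.map (algebraMap A B) = J :=
  ⟨J.comap (algebraMap A B), (Ideal.eq_map_comap_of_stable Γ t ht b c hdual J hJ).symm⟩

end Abstract

/-! ## §1b The instance `A ⊗_k L`, `L/k` finite Galois: ideals stable under `id ⊗ Gal(L/k)` are extended from `A` -/

section Tensor

open scoped TensorProduct

variable (k A L : Type*) [Field k] [CommRing A] [Algebra k A] [Field L] [Algebra k L] [FiniteDimensional k L]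

/-- The `A`-valued trace `id ⊗ tr_{L/k}` on `A ⊗_k L`. (Local abbreviation through a `theorem`-free `let`; no `def`.) [folklore] -/
theorem exists_traceDatum [IsGalois k L] :
    ∃ (t : A ⊗[k] L → A) (ι : Type) (_ : Fintype ι) (b c : ι → A ⊗[k] L),
      (∀ y, algebraMap A (A ⊗[k] L) (t y) =
          ∑ g : L ≃ₐ[k] L, Algebra.TensorProduct.map (AlgHom.id A A) (g : L →ₐ[k] L) y) ∧
      (∀ x, x = ∑ i, algebraMap A (A ⊗[k] L) (t (x * b i)) * c i) := by
  classical
  -- the trace `t = rid ∘ (id ⊗ tr)`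
  let t : A ⊗[k] L → A := fun y => TensorProduct.rid k A (LinearMap.lTensor A (Algebra.trace k L) y)
  have ht_add : ∀ x y, t (x + y) = t x + t y := fun x y => by simp only [t, map_add]
  have ht_zero : t 0 = 0 := by simp only [t, map_zero]
  have ht_tmul : ∀ (a : A) (l : L), t (a ⊗ₜ l) = Algebra.trace k L l • a := fun a l => by
    simp only [t, LinearMap.lTensor_tmul, TensorProduct.rid_tmul]
  -- a basis `e` of `L/k` and its trace-dual basis `e*`
  let e := Module.finBasis k L
  let es := (Algebra.traceForm k L).dualBasis (traceForm_nondegenerate k L) e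
  refine ⟨t, Fin (Module.finrank k L), inferInstance, fun i => 1 ⊗ₜ e i, fun i => 1 ⊗ₜ es i, fun y => ?_, fun x => ?_⟩
  · -- `φ(t y) = Σ_g (id ⊗ g) y`
    induction y using TensorProduct.induction_on with
    | zero => simp only [ht_zero, map_zero, Finset.sum_const_zero]
    | tmul a l =>
      rw [ht_tmul, Algebra.TensorProduct.algebraMap_apply, Algebra.algebraMap_self, RingHom.id_apply,
        TensorProduct.smul_tmul, Algebra.smul_def, mul_one, trace_eq_sum_automorphisms, TensorProduct.tmul_sum]
      refine Finset.sum_congr rfl fun g _ => ?_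
      rw [Algebra.TensorProduct.map_tmul, AlgHom.coe_id, id]
      rfl
    | add x y hx hy => simp only [ht_add, map_add, hx, hy, Finset.sum_add_distrib]
  · -- reproducing identity `x = Σᵢ φ(t(x·(1⊗eᵢ))) · (1⊗e*ᵢ)`
    induction x using TensorProduct.induction_on with
    | zero => simp only [zero_mul, ht_zero, map_zero, Finset.sum_const_zero]
    | tmul a l =>
      have hrep : ∀ i, Algebra.trace k L (l * e i) = es.repr l i := fun i => by
        rw [LinearMap.BilinForm.dualBasis_repr_apply, Algebra.traceForm_apply]
      conv_lhs => rw [← es.sum_repr l, TensorProduct.tmul_sum]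
      refine Finset.sum_congr rfl fun i _ => ?_
      rw [Algebra.TensorProduct.tmul_mul_tmul, mul_one, ht_tmul, Algebra.TensorProduct.algebraMap_apply,
        Algebra.algebraMap_self, RingHom.id_apply, Algebra.TensorProduct.tmul_mul_tmul, mul_one, one_mul,
        TensorProduct.smul_tmul, hrep]
    | add x y hx hy =>
      conv_lhs => rw [hx, hy]
      rw [← Finset.sum_add_distrib]
      refine Finset.sum_congr rfl fun i _ => ?_
      rw [add_mul, ht_add, map_add, add_mul]

/-- **GALOIS DESCENT OF IDEALS for `A ⊗_k L`** (`L/k` finite Galois, `A` any commutative `k`-algebra): an ideal of `A ⊗_k L` stable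
under `id_A ⊗ g` for every `g ∈ Gal(L/k)` is extended from `A`.  (Speiser; the trace-dual-basis proof of §1.) [folklore] -/
theorem Ideal.eq_map_comap_of_galois_stable [IsGalois k L] (J : Ideal (A ⊗[k] L))
    (hJ : ∀ g : L ≃ₐ[k] L, ∀ x ∈ J, Algebra.TensorProduct.map (AlgHom.id A A) (g : L →ₐ[k] L) x ∈ J) :
    J = (J.comap (algebraMap A (A ⊗[k] L))).map (algebraMap A (A ⊗[k] L)) := by
  classical
  obtain ⟨t, ι, _, b, c, ht, hdual⟩ := exists_traceDatum k A L
  exact Ideal.eq_map_comap_of_stable (fun g : L ≃ₐ[k] L => Algebra.TensorProduct.map (AlgHom.id A A) (g : L →ₐ[k] L))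
    t ht b c hdual J hJ

/-- The `∃`-form. [folklore] -/
theorem exists_map_eq_of_galois_stable [IsGalois k L] (J : Ideal (A ⊗[k] L))
    (hJ : ∀ g : L ≃ₐ[k] L, ∀ x ∈ J, Algebra.TensorProduct.map (AlgHom.id A A) (g : L →ₐ[k] L) x ∈ J) :
    ∃ I : Ideal A, I.map (algebraMap A (A ⊗[k] L)) = J :=
  ⟨_, (Ideal.eq_map_comap_of_galois_stable k A L J hJ).symm⟩

end Tensor

/-! ## §2 Stable two-flag filtrations are rational -/

section Flags

variable {S S' : Type} [CommRing S] [CommRing S'] [IsLocalRing S] [IsLocalRing S'] [Algebra S S'] [Module.Flat S S']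

/-- **STABLE LEVELS ⇒ RATIONAL TWO-FLAG.**  `φ : S → S'` flat local, `𝔪S' = 𝔪'`, with a trace-descent datum `(Γ, t, b, c)`; a
two-flag `(g₁', g₂')` of `S'` whose levels `F'(r₁)`, `F'(r₂)` are `Γ`-stable has the filtration of a two-flag of `S`.
[cite: Hironaka1967, §3] [OURS · L1 W4.3 · (o53-desc′) (G4)] -/
theorem exists_isTwoFlag_eq_of_stable (h𝔪 : (maximalIdeal S).map (algebraMap S S') = maximalIdeal S')
    {κ ι : Type*} [Fintype κ] [Fintype ι] (Γ : κ → (S' →ₐ[S] S')) (t : S' → S)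
    (ht : ∀ y, algebraMap S S' (t y) = ∑ k, Γ k y) (b c : ι → S')
    (hdual : ∀ x, x = ∑ i, algebraMap S S' (t (x * b i)) * c i)
    {g₁' g₂' : S'} (hfl' : IsTwoFlag g₁' g₂') {q r₁ r₂ : ℕ} (hadm : AdmissibleTriple q r₁ r₂)
    (hst₁ : ∀ k, ∀ x ∈ flagContactFiltration g₁' g₂' q r₁ r₂ r₁, Γ k x ∈ flagContactFiltration g₁' g₂' q r₁ r₂ r₁)
    (hst₂ : ∀ k, ∀ x ∈ flagContactFiltration g₁' g₂' q r₁ r₂ r₂, Γ k x ∈ flagContactFiltration g₁' g₂' q r₁ r₂ r₂) :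
    ∃ g₁ g₂ : S, IsTwoFlag g₁ g₂ ∧
      ∀ n, flagContactFiltration (algebraMap S S' g₁) (algebraMap S S' g₂) q r₁ r₂ n =
        flagContactFiltration g₁' g₂' q r₁ r₂ n := by
  obtain ⟨I₁, hI₁⟩ := exists_map_eq_of_stable Γ t ht b c hdual _ hst₁
  obtain ⟨I₂, hI₂⟩ := exists_map_eq_of_stable Γ t ht b c hdual _ hst₂
  obtain ⟨g₁, g₂, hfl, -, -, heq⟩ := JFlatEssSmooth.exists_isTwoFlag_eq_of_extended h𝔪 hfl' hadm hI₁ hI₂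
  exact ⟨g₁, g₂, hfl, heq⟩

/-- **Reach descends through stable levels.** [cite: Hironaka1967, §3] [cite: EGA0IV, 0_IV (19.7.1)] [OURS · L1 W4.3 · (o53-desc′) (G4)] -/
theorem flagReaches_of_stable (h𝔪 : (maximalIdeal S).map (algebraMap S S') = maximalIdeal S')
    {κ ι : Type*} [Fintype κ] [Fintype ι] (Γ : κ → (S' →ₐ[S] S')) (t : S' → S)
    (ht : ∀ y, algebraMap S S' (t y) = ∑ k, Γ k y) (b c : ι → S')
    (hdual : ∀ x, x = ∑ i, algebraMap S S' (t (x * b i)) * c i)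
    {g₁' g₂' : S'} (hfl' : IsTwoFlag g₁' g₂') {q r₁ r₂ : ℕ} (hadm : AdmissibleTriple q r₁ r₂)
    (hst₁ : ∀ k, ∀ x ∈ flagContactFiltration g₁' g₂' q r₁ r₂ r₁, Γ k x ∈ flagContactFiltration g₁' g₂' q r₁ r₂ r₁)
    (hst₂ : ∀ k, ∀ x ∈ flagContactFiltration g₁' g₂' q r₁ r₂ r₂, Γ k x ∈ flagContactFiltration g₁' g₂' q r₁ r₂ r₂)
    {f : S} {ν : ℕ} (hf : algebraMap S S' f ∈ flagContactFiltration g₁' g₂' q r₁ r₂ (r₁ * ν)) :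
    FlagReaches f ν q r₁ r₂ := by
  obtain ⟨I₁, hI₁⟩ := exists_map_eq_of_stable Γ t ht b c hdual _ hst₁
  obtain ⟨I₂, hI₂⟩ := exists_map_eq_of_stable Γ t ht b c hdual _ hst₂
  exact JFlatEssSmooth.flagReaches_of_extended h𝔪 hfl' hadm hI₁ hI₂ hf

omit [IsLocalRing S] [Module.Flat S S'] in
/-- **Filtrations move under `S`-algebra endomorphisms preserving `𝔪'`**: `γ(F_{g₁',g₂'}(n)) ⊆ F_{γ g₁', γ g₂'}(n)`.  So a level of
a flag is `Γ`-stable as soon as each `γ ∈ Γ` maps the flag to a flag with the SAME filtration — e.g. two σ-maximisers under (J-can).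
[folklore] -/
theorem map_flagContactFiltration_le_of_endo {γ : S' →ₐ[S] S'} (hγ : (maximalIdeal S').map (γ : S' →+* S') ≤ maximalIdeal S')
    (g₁' g₂' : S') (q r₁ r₂ n : ℕ) {x : S'} (hx : x ∈ flagContactFiltration g₁' g₂' q r₁ r₂ n) :
    γ x ∈ flagContactFiltration (γ g₁') (γ g₂') q r₁ r₂ n :=
  map_mem_flagContactFiltration (γ : S' →+* S') hγ hx

omit [IsLocalRing S] [Module.Flat S S'] in
/-- The stability criterion: if for every `γ ∈ Γ` the moved flag `(γ g₁', γ g₂')` has the same filtration at level `m`, then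
`F'(m)` is `Γ`-stable. [folklore] -/
theorem stable_of_forall_eq {κ : Type*} (Γ : κ → (S' →ₐ[S] S'))
    (hΓ : ∀ k, (maximalIdeal S').map (Γ k : S' →+* S') ≤ maximalIdeal S') (g₁' g₂' : S') (q r₁ r₂ m : ℕ)
    (heq : ∀ k, flagContactFiltration (Γ k g₁') (Γ k g₂') q r₁ r₂ m = flagContactFiltration g₁' g₂' q r₁ r₂ m) :
    ∀ k, ∀ x ∈ flagContactFiltration g₁' g₂' q r₁ r₂ m, Γ k x ∈ flagContactFiltration g₁' g₂' q r₁ r₂ m :=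
  fun k _ hx => heq k ▸ map_flagContactFiltration_le_of_endo (hΓ k) g₁' g₂' q r₁ r₂ m hx

end Flags

end TraceDescent

end Summit.ResolutionOfSingularities.ResolutionOfSingularities.Theorems

end
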